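import Literature.Topology.FourManifolds.PropertyRAlexanderModule
import Literature.Topology.FourManifolds.SurgeryGluckProofs
import HarnessLib

/-!
# Property R is equivalent to its Alexander-polynomial-one case

Topic `Literature/Topology/FourManifolds`; sibling of `PropertyRAlexanderModule.lean` (the
Alexander-module obstruction: if `S² × S¹` is `0`-surgery on `K` then `Δ_K ≐ 1`,
`Literature.Topology.FourManifolds.Knot.hasTrivialAlexanderPolynomial_of_isIntegralSurgery_sphereTwo_prod_zero`)
and of `SurgeryGluck.lean` / `SurgeryGluckProofs.lean` (the named facts
`Literature.Topology.FourManifolds.isUnknot_of_isIntegralSurgery_zero` — Property R, Gabai (1987) —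
and `Literature.Topology.FourManifolds.isIntegralSurgery_sphereTwo_prod_zero_iff`, with the proved
comparison `Literature.Topology.FourManifolds.isIntegralSurgery_sphereTwo_prod_zero_iff_iff_propertyR`).
Written for the fact seat of Property R. **Everything in this file is proved; no definition of a
`Prop`, no named fact, no `sorry`.**

* `isUnknot_of_isIntegralSurgery_zero_iff_alexanderOne` — Property R is *equivalent* to its
  restriction to knots with trivial Alexander polynomial (`K.HasTrivialAlexanderPolynomial`, i.e.
  `Δ_K ≐ 1`): every other knot is settled by the Alexander-module obstruction.
* `isUnknot_of_isIntegralSurgery_zero_of_alexanderOne` — the useful direction, as an implication.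
* `isIntegralSurgery_sphereTwo_prod_zero_iff_iff_alexanderOne` — the same reduction for the `iff`
  form of Property R.

So what separates the tree from `isUnknot_of_isIntegralSurgery_zero_holds` (and from
`isIntegralSurgery_sphereTwo_prod_zero_iff_holds`) is exactly the statement *a knot with
`Δ_K ≐ 1` on which `0`-surgery yields `S² × S¹` is unknotted*. Historically this is the form in
which Property R stood open before 1987 (the case `Δ_K ≠ 1` being the classical homological
observation; cf. Kirby's problem list (1978), Problem 1.16), and it is settled only by Gabai's
theorem (Gabai, *Foliations and the topology of 3-manifolds. III*,
J. Differential Geom. 26 (1987), Cor. 8.3 with Remark 8.5, p. 525–526: zero frame surgery on a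
knot `k` yields a prime manifold in which the capped-off minimal genus Seifert surface is of least
genus among nonseparating surfaces; proved by sutured manifold hierarchies and taut foliations),
recorded in the tree as the named fact
`Literature.Topology.FourManifolds.Knot.hasSeifertSurfaceOfGenus_le_of_isIntegralSurgery_zero`
(Cor. 8.3, genus clause) feeding the proved reduction
`Literature.Topology.FourManifolds.isUnknot_of_isIntegralSurgery_zero_of_gabai83`
(`SliceGenusUnknotLeaves.lean`). Nothing here proves that case.

## References

* D. Gabai, *Foliations and the topology of 3-manifolds. III*, J. Differential Geom. 26 (1987)
  479–536, Cor. 8.3 and Remark 8.5. [GabaiJDG1987]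
* R. Kirby, *Problems in low dimensional manifold theory*, Proc. Sympos. Pure Math. 32 (1978),
  Problem 1.16 (Property R).
* D. Rolfsen, *Knots and Links* (1976), §7 (Alexander module), §9.F–G (surgery). [Rolfsen1976]

## Design notes

* Theorems only; the residual case enters as an explicit hypothesis of the reduction theorems, never
  as a named fact (D-0026).
* `S² × S¹` is written `↥(Metric.sphere 0 1) × ↥(Metric.sphere 0 1)` in `EuclideanSpace ℝ (Fin 3)`
  and `EuclideanSpace ℝ (Fin 2)`, definitionally the `(𝕊 2) × (𝕊 1)` of `SurgeryGluck.lean`.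
-/

noncomputable section

open scoped Manifold

namespace Literature.Topology.FourManifolds

/-- **Property R is equivalent to Property R for knots with `Δ_K ≐ 1`.** The direction `←` feeds a
knot `K` with `S² × S¹` as a `0`-surgery first to the Alexander-module obstruction
(`Knot.hasTrivialAlexanderPolynomial_of_isIntegralSurgery_sphereTwo_prod_zero`: then `Δ_K ≐ 1`) and
then to the hypothesis. The right-hand side is the case of Property R settled by Gabai (1987),
Cor. 8.3 / Remark 8.5, and by nothing more elementary. [cite: GabaiJDG1987, Cor. 8.3 and Remark 8.5] -/
theorem isUnknot_of_isIntegralSurgery_zero_iff_alexanderOne :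
    isUnknot_of_isIntegralSurgery_zero ↔
      ∀ K : Knot, K.HasTrivialAlexanderPolynomial →
        IsIntegralSurgery ((𝓡 2).prod (𝓡 1))
          ((Metric.sphere (0 : EuclideanSpace ℝ (Fin 3)) 1) ×
            (Metric.sphere (0 : EuclideanSpace ℝ (Fin 2)) 1)) K 0 → K.IsUnknot :=
  ⟨fun h K _ hK ↦ h K hK, fun h K hK ↦
    h K (Knot.hasTrivialAlexanderPolynomial_of_isIntegralSurgery_sphereTwo_prod_zero hK) hK⟩

/-- **Property R from its Alexander-polynomial-one case**: if every knot `K` with `Δ_K ≐ 1` on which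
`0`-surgery yields `S² × S¹` is unknotted, then Property R (`isUnknot_of_isIntegralSurgery_zero`)
holds — knots with `Δ_K ≠ 1` never have `S² × S¹` as a `0`-surgery
(`Knot.not_isIntegralSurgery_sphereTwo_prod_zero_of_not_isUnit`).
[cite: GabaiJDG1987, Cor. 8.3 and Remark 8.5] -/
theorem isUnknot_of_isIntegralSurgery_zero_of_alexanderOne
    (h : ∀ K : Knot, K.HasTrivialAlexanderPolynomial →
      IsIntegralSurgery ((𝓡 2).prod (𝓡 1))
        ((Metric.sphere (0 : EuclideanSpace ℝ (Fin 3)) 1) ×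
          (Metric.sphere (0 : EuclideanSpace ℝ (Fin 2)) 1)) K 0 → K.IsUnknot) :
    isUnknot_of_isIntegralSurgery_zero :=
  isUnknot_of_isIntegralSurgery_zero_iff_alexanderOne.2 h

/-- **The `iff` form of Property R is equivalent to the same Alexander-polynomial-one case**
(`isIntegralSurgery_sphereTwo_prod_zero_iff_iff_propertyR`: the `iff` fact is equivalent to
Property R, its direction `←` being the theorem `isIntegralSurgery_sphereTwo_prod_zero_of_isUnknot`).
[cite: GabaiJDG1987, Cor. 8.3 and Remark 8.5] -/
theorem isIntegralSurgery_sphereTwo_prod_zero_iff_iff_alexanderOne :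
    isIntegralSurgery_sphereTwo_prod_zero_iff ↔
      ∀ K : Knot, K.HasTrivialAlexanderPolynomial →
        IsIntegralSurgery ((𝓡 2).prod (𝓡 1))
          ((Metric.sphere (0 : EuclideanSpace ℝ (Fin 3)) 1) ×
            (Metric.sphere (0 : EuclideanSpace ℝ (Fin 2)) 1)) K 0 → K.IsUnknot :=
  isIntegralSurgery_sphereTwo_prod_zero_iff_iff_propertyR.trans
    isUnknot_of_isIntegralSurgery_zero_iff_alexanderOne

end Literature.Topology.FourManifolds

end
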